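import Summits.Ventures.CertifiedManyBodySolver.Downfold.BoxesLa214V115M2cPhaseSeparationThermalFreeDilute
import Summits.Ventures.CertifiedManyBodySolver.Downfold.BoxesLa214V115M2cPhaseSeparationGrandCanonicalThermalGap
import Summits.Ventures.CertifiedManyBodySolver.Observables.PhaseSeparationExclusionBoxGrandCanonicalThermalFreeDilute
import HarnessLib

/-!
# Ventures/CertifiedManyBodySolver — Downfold/BoxesLa214V115M2cPhaseSeparationGrandCanonicalThermalFreeDilute.lean: the LSCO `x = 1/8` box's
# competing-order word ON THE μ AXIS at `T > 0`, right `t′`-half `[−1/4, −1/5] × U ∈ [8, 81/10]`, RE-PRICED with the FREE-GAS DILUTE ANCHOR —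
# no `(β, μ)` carries both a `≤ 1/5`-filled and a `≥ 1`-filled equilibrium ∀`β ≥ 10` (g24: `12`); `Δμ ≥ t/10` ∀`β ≥ 13` (`16`), `≥ t/5` ∀`β ≥ 19` (`23`),
# `≥ t/4` ∀`β ≥ 24` (`29`); `(≤ 1/4 | ≥ 1)`: no `(β, μ)` carries both ∀`β ≥ 16`

HONEST FRAMING: first certified bounds; not a superconductivity verdict. CLASS = DERIVED / CONTEXT on a SCREENING-GRADE material box — CONTROL
class (dilute partner: hole doping `≥ 80 %` / `≥ 75 %`); the μ-axis reading (laws g22/g23: `Literature/…/TIDensityPhaseCoexistenceGrandCanonical.lean`,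
`…HubbardTTPrimePhaseCoexistenceExclusionGrandCanonical.lean`; a TI variational equilibrium of `H − μN` is a canonical one at its own density, `−βμ` a
supergradient of `p(β; ·)`, one Jensen step) of this seat's g25 thermal cells (`…ThermalFreeDilute.lean`): SAME cap plane, `n = 1` law at `U = 8`, dilute floor,
`n₂`-anchor `cert_feC1tt_stair221_tpm1o4_b2_j300793` (read at `n = 1`, band `|t′| ≤ 1/4 × U ≥ 8`), and the KERNEL free-gas dilute anchor
(`lsco_freeDiluteCap_{1o5,1o4}_right`; `Certificates/HubbardTTPrime_freeGC_kernelQuadrature_b8_{tpm1o4,tpm1o5}_dilute.lean`, no claim node); forms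
`psGCT_{not_equilibrium,gap}_above_column_hotAnchorSS` (g25). Thresholds `β₀(g) = max over s-ends of [a Q₁(s) + bΠ + 8aF₁(s) + 2bL₈(s)]/(M(s, 81/10) − g)`,
`g = Δμ·a·b·(1 − n₁)` (exact scan `gen-g25/gen_W6.py`): exclusion `9.63 ⇒ β ≥ 10`; `Δμ ≥ 1/10`: `12.59 ⇒ 13`; `1/5`: `18.18 ⇒ 19`; `1/4`: `23.36 ⇒ 24`
(`T = 0` limit `33/100`, p664356); `(≤ 1/4 | ≥ 1)` exclusion `15.87 ⇒ 16`. READING (CONTROL, μ axis of the D-0098 map; `t ∈ [0.34, 0.40]` eV [float]): «LSCO x = 1/8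
one-band box, t′/t ∈ [−0.25, −0.20] × U/t ∈ [8.0, 8.1]: at T ≲ 400 K no chemical potential carries both a ≥ 1-filled and a ≤ 1/5-filled equilibrium state;
at T ≲ 300 K their chemical potentials differ by ≥ t/10 ≈ 35–40 meV». Statements about translation-invariant variational equilibria of `H(1,s,U) − μN`
(existence not claimed); FLOORS on `Δμ`, not estimates; nothing about stripes, SC or `T_c`; no number of record. Zero kit.

Cell `pub/hubbard-downfold` (MO-S1 filling lane; D-0096 (iii), μ axis), seat `hubbard-downfold-unc-2` (g25). Generator `gen-g25/gen_W6.py` (exact-ℚ asserts).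
References: [Israel1979] Thm I.2.4 / I.3.4; [Ruelle1969] §3.4; [Griffiths1966] §II; [PoulinHastings2011]; [EmeryKivelsonLin1990].
-/

noncomputable section

namespace Summit.Ventures.CertifiedManyBodySolver.Downfold

open Summit.Ventures.CertifiedManyBodySolver.Observables Summit.Ventures.CertifiedManyBodySolver.Certificates Summit.Ventures.CertifiedManyBodySolver.Downfold
open Literature.MathematicalPhysics.QuantumLattice Literature.MathematicalPhysics.QuantumLattice.ThermodynamicLimit InfVolFermionState Set Filter

/-! ## §1 `(≤ 1/5 | ≥ 1)` on `t′ ∈ [−1/4, −1/5] × U ∈ [8, 81/10]`: one-`(β, μ)` exclusion and `Δμ` gaps -/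

/-- **ONE-`(β, μ)` EXCLUSION, every `β ≥ 10`** on `t′ ∈ [−1/4, −1/5] × U ∈ [8, 81/10]` (`β₀ = 9.63`; g24 `12`): if a translation-invariant variational equilibrium of `H(1,s,U) − μN` at `β` has density `≤ 1/5`, NO equilibrium at the same `(β, μ)` has density `≥ 1`. [cite: Israel1979, Thm. I.2.4] [cite: Griffiths1966, §II] [cite: PoulinHastings2011, eqs. (3)–(8)] [cite: Ruelle1969, §3.4] -/
theorem lsco78_gcTF_not_equilibrium_le_1o5_ge_one_beta10_right (hVB : cert_obx32x4tpm1o4D1200_openbox_32x4_N112_planes)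
    (hK8 : cert_laBoxE_K2diag_GU8n1tpm3o10_j299783_up)
    (h472 : cert_r472_pb2_tl_upper_n1_U8) (h428 : cert_r428_hubSQ_hanK7R6_U8_r5_e4_so4blk)
    (hC1 : cert_feC1tt_stair221_tpm1o4_b2_j300793)
    {s : ℝ} (hs : s ∈ Icc (-1 / 4 : ℝ) (-1 / 5)) {U : ℝ} (hU : U ∈ Icc (8 : ℝ) (81 / 10))
    {β : ℝ} (hβ : (10 : ℝ) ≤ β) {μ : ℝ} {ω₁ ω₂ : InfVolFermionState 2}
    (hω₁ : ω₁.IsVarEquilibrium β (gcInteractionTT' 1 s U μ 0) 1) (hρ₁ : ω₁.density ≤ 1 / 5) (hρ₂ : 1 ≤ ω₂.density) :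
    ¬ ω₂.IsVarEquilibrium β (gcInteractionTT' 1 s U μ 0) 1 := by
  refine psGCT_not_equilibrium_above_column_hotAnchorSS 1 (s₁ := -1 / 4) (s₂ := -1 / 5) (U₂ := 8) (U₃ := 81 / 10)
    (n₁ := 1 / 5) (n₂ := 1) (a := 5 / 32) (b := 27 / 32) (β₀ := 10) (βh₁ := 8) (βh₂ := 2)
    (by norm_num) (by norm_num) (by norm_num) (by norm_num) (by norm_num) (by norm_num) (by norm_num) (by norm_num)
    (by norm_num) (by norm_num) (by norm_num) (by norm_num) hβ (by norm_num)
    (lsco78_capPlane_on_cell_of hVB (by norm_num) (by norm_num) (by norm_num))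
    (fun s hs => lsco_n1_law8_of hK8 h472 h428 s ⟨hs.1.trans' (by norm_num), hs.2.trans (by norm_num)⟩)
    (fun s hs U hU => lsco_dilute14_floor_right (n₁ := 1 / 5) (by norm_num) (by norm_num) s hs U (by linarith [hU.1]))
    (lsco_freeDiluteCap_1o5_right (by norm_num) (by norm_num) (by norm_num))
    (lsco_hotCap_n1_b2_j300793_on_cell hC1 (by norm_num) (by norm_num) (by norm_num))
    ?_ ?_ hs hU hω₁ (meanEnergy_gcInteractionTT'_zero_field_eq_sub 1 s U μ) hρ₁ hρ₂
  · intro s hs; obtain ⟨h1, h2⟩ := hs; push_cast; norm_num; nlinarith [h1, h2]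
  · intro s hs; obtain ⟨h1, h2⟩ := hs; push_cast; norm_num; nlinarith [h1, h2]

/-- **`Δμ ≥ t/10` for every `β ≥ 13`** on `t′ ∈ [−1/4, −1/5] × U ∈ [8, 81/10]` (`β₀ = 12.59`, `g = 27/2560`; g24 `16`). [cite: Israel1979, Thm. I.2.4] [cite: Griffiths1966, §II] [cite: PoulinHastings2011, eqs. (3)–(8)] [cite: Ruelle1969, §3.4] -/
theorem lsco78_gcTF_chemPot_gap_1o10_le_1o5_ge_one_beta13_right (hVB : cert_obx32x4tpm1o4D1200_openbox_32x4_N112_planes)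
    (hK8 : cert_laBoxE_K2diag_GU8n1tpm3o10_j299783_up)
    (h472 : cert_r472_pb2_tl_upper_n1_U8) (h428 : cert_r428_hubSQ_hanK7R6_U8_r5_e4_so4blk)
    (hC1 : cert_feC1tt_stair221_tpm1o4_b2_j300793)
    {s : ℝ} (hs : s ∈ Icc (-1 / 4 : ℝ) (-1 / 5)) {U : ℝ} (hU : U ∈ Icc (8 : ℝ) (81 / 10))
    {β : ℝ} (hβ : (13 : ℝ) ≤ β) {μ₁ μ₂ : ℝ} {ω₁ ω₂ : InfVolFermionState 2}
    (hω₁ : ω₁.IsVarEquilibrium β (gcInteractionTT' 1 s U μ₁ 0) 1) (hρ₁ : ω₁.density ≤ 1 / 5)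
    (hω₂ : ω₂.IsVarEquilibrium β (gcInteractionTT' 1 s U μ₂ 0) 1) (hρ₂ : 1 ≤ ω₂.density) :
    (1 : ℝ) / 10 ≤ μ₂ - μ₁ := by
  have k := psGCT_gap_above_column_hotAnchorSS 1 (s₁ := -1 / 4) (s₂ := -1 / 5) (U₂ := 8) (U₃ := 81 / 10)
    (n₁ := 1 / 5) (n₂ := 1) (a := 5 / 32) (b := 27 / 32) (β₀ := 13) (βh₁ := 8) (βh₂ := 2) (g := 27 / 2560)
    (by norm_num) (by norm_num) (by norm_num) (by norm_num) (by norm_num) (by norm_num) (by norm_num) (by norm_num)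
    (by norm_num) (by norm_num) (by norm_num) (by norm_num) (by norm_num)
    (lsco78_capPlane_on_cell_of hVB (by norm_num) (by norm_num) (by norm_num))
    (fun s hs => lsco_n1_law8_of hK8 h472 h428 s ⟨hs.1.trans' (by norm_num), hs.2.trans (by norm_num)⟩)
    (fun s hs U hU => lsco_dilute14_floor_right (n₁ := 1 / 5) (by norm_num) (by norm_num) s hs U (by linarith [hU.1]))
    (lsco_freeDiluteCap_1o5_right (by norm_num) (by norm_num) (by norm_num))
    (lsco_hotCap_n1_b2_j300793_on_cell hC1 (by norm_num) (by norm_num) (by norm_num))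
    ?_ ?_ hs hU hβ hω₁ (meanEnergy_gcInteractionTT'_zero_field_eq_sub 1 s U μ₁) hω₂
    (meanEnergy_gcInteractionTT'_zero_field_eq_sub 1 s U μ₂) hρ₁ hρ₂
  · linarith
  · intro s hs; obtain ⟨h1, h2⟩ := hs; push_cast; norm_num; nlinarith [h1, h2]
  · intro s hs; obtain ⟨h1, h2⟩ := hs; push_cast; norm_num; nlinarith [h1, h2]

/-- **`Δμ ≥ t/5` for every `β ≥ 19`** on `t′ ∈ [−1/4, −1/5] × U ∈ [8, 81/10]` (`β₀ = 18.18`, `g = 27/1280`; g24 `23`). [cite: Israel1979, Thm. I.2.4] [cite: Griffiths1966, §II] [cite: PoulinHastings2011, eqs. (3)–(8)] [cite: Ruelle1969, §3.4] -/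
theorem lsco78_gcTF_chemPot_gap_1o5_le_1o5_ge_one_beta19_right (hVB : cert_obx32x4tpm1o4D1200_openbox_32x4_N112_planes)
    (hK8 : cert_laBoxE_K2diag_GU8n1tpm3o10_j299783_up)
    (h472 : cert_r472_pb2_tl_upper_n1_U8) (h428 : cert_r428_hubSQ_hanK7R6_U8_r5_e4_so4blk)
    (hC1 : cert_feC1tt_stair221_tpm1o4_b2_j300793)
    {s : ℝ} (hs : s ∈ Icc (-1 / 4 : ℝ) (-1 / 5)) {U : ℝ} (hU : U ∈ Icc (8 : ℝ) (81 / 10))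
    {β : ℝ} (hβ : (19 : ℝ) ≤ β) {μ₁ μ₂ : ℝ} {ω₁ ω₂ : InfVolFermionState 2}
    (hω₁ : ω₁.IsVarEquilibrium β (gcInteractionTT' 1 s U μ₁ 0) 1) (hρ₁ : ω₁.density ≤ 1 / 5)
    (hω₂ : ω₂.IsVarEquilibrium β (gcInteractionTT' 1 s U μ₂ 0) 1) (hρ₂ : 1 ≤ ω₂.density) :
    (1 : ℝ) / 5 ≤ μ₂ - μ₁ := by
  have k := psGCT_gap_above_column_hotAnchorSS 1 (s₁ := -1 / 4) (s₂ := -1 / 5) (U₂ := 8) (U₃ := 81 / 10)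
    (n₁ := 1 / 5) (n₂ := 1) (a := 5 / 32) (b := 27 / 32) (β₀ := 19) (βh₁ := 8) (βh₂ := 2) (g := 27 / 1280)
    (by norm_num) (by norm_num) (by norm_num) (by norm_num) (by norm_num) (by norm_num) (by norm_num) (by norm_num)
    (by norm_num) (by norm_num) (by norm_num) (by norm_num) (by norm_num)
    (lsco78_capPlane_on_cell_of hVB (by norm_num) (by norm_num) (by norm_num))
    (fun s hs => lsco_n1_law8_of hK8 h472 h428 s ⟨hs.1.trans' (by norm_num), hs.2.trans (by norm_num)⟩)
    (fun s hs U hU => lsco_dilute14_floor_right (n₁ := 1 / 5) (by norm_num) (by norm_num) s hs U (by linarith [hU.1]))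
    (lsco_freeDiluteCap_1o5_right (by norm_num) (by norm_num) (by norm_num))
    (lsco_hotCap_n1_b2_j300793_on_cell hC1 (by norm_num) (by norm_num) (by norm_num))
    ?_ ?_ hs hU hβ hω₁ (meanEnergy_gcInteractionTT'_zero_field_eq_sub 1 s U μ₁) hω₂
    (meanEnergy_gcInteractionTT'_zero_field_eq_sub 1 s U μ₂) hρ₁ hρ₂
  · linarith
  · intro s hs; obtain ⟨h1, h2⟩ := hs; push_cast; norm_num; nlinarith [h1, h2]
  · intro s hs; obtain ⟨h1, h2⟩ := hs; push_cast; norm_num; nlinarith [h1, h2]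

/-- **`Δμ ≥ t/4` for every `β ≥ 24`** on `t′ ∈ [−1/4, −1/5] × U ∈ [8, 81/10]` (`β₀ = 23.36`, `g = 27/1024`; g24 `29`; `T = 0` gap `33/100`). [cite: Israel1979, Thm. I.2.4] [cite: Griffiths1966, §II] [cite: PoulinHastings2011, eqs. (3)–(8)] [cite: Ruelle1969, §3.4] -/
theorem lsco78_gcTF_chemPot_gap_1o4_le_1o5_ge_one_beta24_right (hVB : cert_obx32x4tpm1o4D1200_openbox_32x4_N112_planes)
    (hK8 : cert_laBoxE_K2diag_GU8n1tpm3o10_j299783_up)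
    (h472 : cert_r472_pb2_tl_upper_n1_U8) (h428 : cert_r428_hubSQ_hanK7R6_U8_r5_e4_so4blk)
    (hC1 : cert_feC1tt_stair221_tpm1o4_b2_j300793)
    {s : ℝ} (hs : s ∈ Icc (-1 / 4 : ℝ) (-1 / 5)) {U : ℝ} (hU : U ∈ Icc (8 : ℝ) (81 / 10))
    {β : ℝ} (hβ : (24 : ℝ) ≤ β) {μ₁ μ₂ : ℝ} {ω₁ ω₂ : InfVolFermionState 2}
    (hω₁ : ω₁.IsVarEquilibrium β (gcInteractionTT' 1 s U μ₁ 0) 1) (hρ₁ : ω₁.density ≤ 1 / 5)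
    (hω₂ : ω₂.IsVarEquilibrium β (gcInteractionTT' 1 s U μ₂ 0) 1) (hρ₂ : 1 ≤ ω₂.density) :
    (1 : ℝ) / 4 ≤ μ₂ - μ₁ := by
  have k := psGCT_gap_above_column_hotAnchorSS 1 (s₁ := -1 / 4) (s₂ := -1 / 5) (U₂ := 8) (U₃ := 81 / 10)
    (n₁ := 1 / 5) (n₂ := 1) (a := 5 / 32) (b := 27 / 32) (β₀ := 24) (βh₁ := 8) (βh₂ := 2) (g := 27 / 1024)
    (by norm_num) (by norm_num) (by norm_num) (by norm_num) (by norm_num) (by norm_num) (by norm_num) (by norm_num)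
    (by norm_num) (by norm_num) (by norm_num) (by norm_num) (by norm_num)
    (lsco78_capPlane_on_cell_of hVB (by norm_num) (by norm_num) (by norm_num))
    (fun s hs => lsco_n1_law8_of hK8 h472 h428 s ⟨hs.1.trans' (by norm_num), hs.2.trans (by norm_num)⟩)
    (fun s hs U hU => lsco_dilute14_floor_right (n₁ := 1 / 5) (by norm_num) (by norm_num) s hs U (by linarith [hU.1]))
    (lsco_freeDiluteCap_1o5_right (by norm_num) (by norm_num) (by norm_num))
    (lsco_hotCap_n1_b2_j300793_on_cell hC1 (by norm_num) (by norm_num) (by norm_num))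
    ?_ ?_ hs hU hβ hω₁ (meanEnergy_gcInteractionTT'_zero_field_eq_sub 1 s U μ₁) hω₂
    (meanEnergy_gcInteractionTT'_zero_field_eq_sub 1 s U μ₂) hρ₁ hρ₂
  · linarith
  · intro s hs; obtain ⟨h1, h2⟩ := hs; push_cast; norm_num; nlinarith [h1, h2]
  · intro s hs; obtain ⟨h1, h2⟩ := hs; push_cast; norm_num; nlinarith [h1, h2]

/-! ## §2 `(≤ 1/4 | ≥ 1)` on `t′ ∈ [−1/4, −1/5] × U ∈ [8, 81/10]`: one-`(β, μ)` exclusion -/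

/-- **ONE-`(β, μ)` EXCLUSION for the `(≤ 1/4 | ≥ 1)` pair, every `β ≥ 16`** on `t′ ∈ [−1/4, −1/5] × U ∈ [8, 81/10]` (`β₀ = 15.87`). [cite: Israel1979, Thm. I.2.4] [cite: Griffiths1966, §II] [cite: PoulinHastings2011, eqs. (3)–(8)] [cite: Ruelle1969, §3.4] -/
theorem lsco78_gcTF_not_equilibrium_le_1o4_ge_one_beta16_right (hVB : cert_obx32x4tpm1o4D1200_openbox_32x4_N112_planes)
    (hK8 : cert_laBoxE_K2diag_GU8n1tpm3o10_j299783_up)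
    (h472 : cert_r472_pb2_tl_upper_n1_U8) (h428 : cert_r428_hubSQ_hanK7R6_U8_r5_e4_so4blk)
    (hC1 : cert_feC1tt_stair221_tpm1o4_b2_j300793)
    {s : ℝ} (hs : s ∈ Icc (-1 / 4 : ℝ) (-1 / 5)) {U : ℝ} (hU : U ∈ Icc (8 : ℝ) (81 / 10))
    {β : ℝ} (hβ : (16 : ℝ) ≤ β) {μ : ℝ} {ω₁ ω₂ : InfVolFermionState 2}
    (hω₁ : ω₁.IsVarEquilibrium β (gcInteractionTT' 1 s U μ 0) 1) (hρ₁ : ω₁.density ≤ 1 / 4) (hρ₂ : 1 ≤ ω₂.density) :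
    ¬ ω₂.IsVarEquilibrium β (gcInteractionTT' 1 s U μ 0) 1 := by
  refine psGCT_not_equilibrium_above_column_hotAnchorSS 1 (s₁ := -1 / 4) (s₂ := -1 / 5) (U₂ := 8) (U₃ := 81 / 10)
    (n₁ := 1 / 4) (n₂ := 1) (a := 1 / 6) (b := 5 / 6) (β₀ := 16) (βh₁ := 8) (βh₂ := 2)
    (by norm_num) (by norm_num) (by norm_num) (by norm_num) (by norm_num) (by norm_num) (by norm_num) (by norm_num)
    (by norm_num) (by norm_num) (by norm_num) (by norm_num) hβ (by norm_num)
    (lsco78_capPlane_on_cell_of hVB (by norm_num) (by norm_num) (by norm_num))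
    (fun s hs => lsco_n1_law8_of hK8 h472 h428 s ⟨hs.1.trans' (by norm_num), hs.2.trans (by norm_num)⟩)
    (fun s hs U hU => lsco_dilute14_floor_right (n₁ := 1 / 4) (by norm_num) (by norm_num) s hs U (by linarith [hU.1]))
    (lsco_freeDiluteCap_1o4_right (by norm_num) (by norm_num) (by norm_num))
    (lsco_hotCap_n1_b2_j300793_on_cell hC1 (by norm_num) (by norm_num) (by norm_num))
    ?_ ?_ hs hU hω₁ (meanEnergy_gcInteractionTT'_zero_field_eq_sub 1 s U μ) hρ₁ hρ₂
  · intro s hs; obtain ⟨h1, h2⟩ := hs; push_cast; norm_num; nlinarith [h1, h2]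
  · intro s hs; obtain ⟨h1, h2⟩ := hs; push_cast; norm_num; nlinarith [h1, h2]

end Summit.Ventures.CertifiedManyBodySolver.Downfold
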